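import Literature.Analysis.FluidPDE.OnsagerBDSVThreeStages
import Literature.Analysis.FluidPDE.OnsagerBDSVStagesProofs
import Literature.Analysis.FunctionSpaces.TorusHolderBridge
import HarnessLib

/-!
# The BDSV scheme: the three stages imply the stage estimates (glue of §2.6)

Buckmaster–De Lellis–Székelyhidi–Vicol (BDSV), *Onsager's conjecture for admissible weak
solutions*, CPAM 72 (2019) = arXiv:1701.08678. The named facts `BDSV.mollificationStage`
(Prop. 2.2), `BDSV.gluingStage` (§2.5) and `BDSV.perturbationStage` (§2.6) of
`OnsagerBDSVThreeStages.lean` imply `BDSV.stagesEstimate` (`OnsagerBDSVStages.lean`), hence — with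
`BDSV.mainIteration_of_stagesEstimate` — the main iterative proposition Prop. 2.1
(`BDSV.mainIteration`). The glue is the opening of §2.6: the energy gap (5.2)
`δ_{q+1}/(2λ_q^α) ≤ e(t) - ∫ |v̄_q|² ≤ 2δ_{q+1}` follows from (2.6), (2.15), (2.22) "by choosing
`a` sufficiently large" (here: `C ℓ^α ≤ λ_q^{-α}/2`, from `ℓ ≤ λ_q^{-1-3α/2}`), and
`‖v̄_q‖₀ ≤ ‖v_q‖₀ + ‖v_ℓ - v_q‖₀ + ‖v̄_q - v_ℓ‖₀ ≤ 3` from (2.5), (2.12), (2.18) (proof of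
Prop. 5.9: "`‖v̄_q‖₀ ≲ 1`"); the constants are threaded (mollification constants into the gluing
stage, gluing constant into the perturbation stage) and the seven estimates of
`BDSV.stagesEstimate` are read off, the `N = 0` cases of (2.13), (2.19) through the bridge
`Torus.eContDiffHolderNorm 1 0 ↦` sup bounds of the field and its first partials
(`TorusHolderBridge`).

Main results: `BDSV.stagesEstimate_of_threeStages` and
`BDSV.mainIteration_of_threeStages : mollificationStage → gluingStage → perturbationStage → mainIteration`.

## References

* T. Buckmaster, C. De Lellis, L. Székelyhidi Jr., V. Vicol, *Onsager's conjecture for admissible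
  weak solutions*, Comm. Pure Appl. Math. 72 (2019) 229–274 = arXiv:1701.08678, §2.6 (first
  paragraph, (5.2)) and the proof of Prop. 5.9 (`‖v̄_q‖₀ ≲ 1`).
-/

open MeasureTheory Set
open scoped NNReal ENNReal ContDiff

noncomputable section

namespace Literature.Analysis.FluidPDE

namespace BDSV

/-! ## From `C^{1,r}` bounds to sup bounds of a field and of its first partials -/

section Bridge

variable {F : Type*} [NormedAddCommGroup F] [NormedSpace ℝ F] {T : ℝ}
  {f : ℝ → UnitAddTorus (Fin 3) → F} {r : ℝ≥0} {B : ℝ}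

/-- `‖f‖₀ ≤ ‖f‖_{1+r}`: a bound `‖f(t)‖_{C^{1,r}} ≤ B` (`B ≥ 0`) on `[0,T]` gives `‖f‖₀ ≤ B`.
[folklore] -/
theorem HolderSupLE.supLE_of_one (h : HolderSupLE T f 1 r B) (hB : 0 ≤ B) : SupLE T f B := by
  intro t ht x
  have h1 : ‖f t x‖ₑ ≤ FunctionSpaces.Torus.eContDiffHolderNorm 1 r (f t) := by
    refine (FunctionSpaces.enorm_le_eSupNorm (f t) x).trans ?_
    rw [FunctionSpaces.Torus.eContDiffHolderNorm, FunctionSpaces.eContDiffHolderNorm_one_eq,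
      ← FunctionSpaces.Torus.eSupNorm_lift]
    exact le_add_right le_self_add
  have h2 := h1.trans (h t ht)
  rwa [← ofReal_norm, ENNReal.ofReal_le_ofReal_iff hB] at h2

/-- `[f]₁ ≤ ‖f‖_{1+r}`: a bound `‖f(t)‖_{C^{1,r}} ≤ B` (`B ≥ 0`) on `[0,T]` for a field with
smooth slices gives `[f]₁ ≤ B` (every first partial bounded by `B`). [folklore] -/
theorem HolderSupLE.derivSupLE_of_one (h : HolderSupLE T f 1 r B) (hB : 0 ≤ B)
    (hf : ∀ t ∈ Icc 0 T, FunctionSpaces.Torus.IsSmooth (f t)) : DerivSupLE T f B := by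
  intro i t ht x
  have h1 : ‖FunctionSpaces.Torus.partialDeriv i (f t) x‖ₑ ≤
      FunctionSpaces.Torus.eContDiffHolderNorm 1 r (f t) :=
    (FunctionSpaces.enorm_le_eSupNorm _ x).trans
      (FunctionSpaces.Torus.eSupNorm_partialDeriv_le ((hf t ht).isContDiff (by simp)) i r)
  have h2 := h1.trans (h t ht)
  rwa [← ofReal_norm, ENNReal.ofReal_le_ofReal_iff hB] at h2

end Bridge

/-! ## A sharper form of (2.11): `ℓ ≤ λ_q^{-1-3α/2}` -/

section MollScale

variable {β α a b : ℝ}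

/-- `ℓ ≤ λ_q^{-(1+3α/2)}` for `a, b ≥ 1`, `β ≥ 0` (since `λ_{q+1}^{-β} ≤ λ_q^{-β}`); in
particular `ℓ^α λ_q^α ≤ λ_q^{-3α²/2} → 0`, which is how "choosing `a` sufficiently large"
absorbs the terms `C δ_{q+1} ℓ^α` of (2.15), (2.22) against `δ_{q+1} λ_q^{-α}` in (5.2).
[cite: BuckmasterEtAl2018, §2.6 (5.2)] -/
theorem mollScale_le_freq_rpow_neg (ha : 1 ≤ a) (hb : 1 ≤ b) (hβ : 0 ≤ β) (q : ℕ) :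
    mollScale β α a b q ≤ freq a b q ^ (-(1 + 3 * α / 2)) := by
  have hf := freq_pos (b := b) ha q
  rw [mollScale_eq ha, div_le_iff₀ (by positivity)]
  calc freq a b (q + 1) ^ (-β) ≤ freq a b q ^ (-β) :=
        Real.rpow_le_rpow_of_nonpos hf (freq_le_freq_succ ha hb q) (by linarith)
    _ = freq a b q ^ (-(1 + 3 * α / 2)) * (freq a b q ^ (-β) * freq a b q ^ (1 + 3 * α / 2)) := by
        rw [← Real.rpow_add hf, ← Real.rpow_add hf]
        congr 1
        ring

/-- `ℓ^α ≤ λ_q^{-α} λ_q^{-3α²/2}` for `α ≥ 0`. [folklore] -/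
theorem mollScale_rpow_le_mul (ha : 1 ≤ a) (hb : 1 ≤ b) (hβ : 0 ≤ β) (hα : 0 ≤ α) (q : ℕ) :
    mollScale β α a b q ^ α ≤ freq a b q ^ (-α) * freq a b q ^ (-(3 * α ^ 2 / 2)) := by
  have hf := freq_pos (b := b) ha q
  calc mollScale β α a b q ^ α ≤ (freq a b q ^ (-(1 + 3 * α / 2))) ^ α :=
        Real.rpow_le_rpow (mollScale_pos ha q).le (mollScale_le_freq_rpow_neg ha hb hβ q) hα
    _ = freq a b q ^ (-α) * freq a b q ^ (-(3 * α ^ 2 / 2)) := by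
        rw [← Real.rpow_mul hf.le, ← Real.rpow_add hf]
        congr 1
        ring

end MollScale

/-! ## The glue -/

section Glue

/-- **The three stages imply the stage estimates** (Buckmaster–De Lellis–Székelyhidi–Vicol 2019,
§2.6, opening paragraph): composing the mollification stage (Prop. 2.2), the gluing stage (§2.5)
and the perturbation stage (§2.6) — the energy gap (5.2) required by the last being a consequence
of (2.6), (2.15), (2.22) for `a` large, and `‖v̄_q‖₀ ≲ 1` of (2.5), (2.12), (2.18) — yields the
seven estimates `BDSV.stagesEstimate` consumed by the proof of Prop. 2.1.
[cite: BuckmasterEtAl2018, §2.6 (5.2)] -/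
theorem stagesEstimate_of_threeStages (h1 : mollificationStage) (h2 : gluingStage)
    (h3 : perturbationStage) : stagesEstimate := by
  obtain ⟨M, hM, h3M⟩ := h3
  refine ⟨M, hM, fun β hβ hβ3 b hb hbβ => ?_⟩
  obtain ⟨α₁, hα₁, h1α⟩ := h1 M hM β hβ hβ3 b hb hbβ
  obtain ⟨α₂, hα₂, h2α⟩ := h2 M hM β hβ hβ3 b hb hbβ
  obtain ⟨α₃, hα₃, h3α⟩ := h3M β hβ hβ3 b hb hbβ
  refine ⟨min (min α₁ α₂) α₃, lt_min (lt_min hα₁ hα₂) hα₃, fun α hα hαlt => ?_⟩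
  have hαlt₁ : α < α₁ := lt_of_lt_of_le hαlt ((min_le_left _ _).trans (min_le_left _ _))
  have hαlt₂ : α < α₂ := lt_of_lt_of_le hαlt ((min_le_left _ _).trans (min_le_right _ _))
  have hαlt₃ : α < α₃ := lt_of_lt_of_le hαlt (min_le_right _ _)
  -- thread the constants: mollification → gluing → perturbation
  obtain ⟨C₁, a₁, ha₁, h1a⟩ := h1α α hα hαlt₁
  obtain ⟨Nbar, h3N⟩ := h3α α hα hαlt₃
  obtain ⟨C₂, a₂, ha₂, h2a⟩ := h2α α hα hαlt₂ Nbar C₁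
  obtain ⟨C₃, a₃, ha₃, h3a⟩ := h3N C₂ 3
  set Cm : ℝ := max (max (C₁ 0) C₂) (max C₃ 1) with hCm
  have hC₁m : C₁ 0 ≤ Cm := (le_max_left _ _).trans (le_max_left _ _)
  have hC₂m : C₂ ≤ Cm := (le_max_right _ _).trans (le_max_left _ _)
  have hC₃m : C₃ ≤ Cm := (le_max_left _ _).trans (le_max_right _ _)
  have hCm1 : 1 ≤ Cm := (le_max_right _ _).trans (le_max_right _ _)
  have hCm0 : 0 ≤ Cm := zero_le_one.trans hCm1
  -- the two parameter thresholds of the glue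
  have hb1 : (1 : ℝ) ≤ b := hb.le
  obtain ⟨a₄, ha₄, h4⟩ := exists_threshold_rpow_neg hb1 hα (by norm_num : (0 : ℝ) < 16) Cm
  have hα2 : 0 < 3 * α ^ 2 / 2 := by positivity
  obtain ⟨a₅, ha₅, h5⟩ := exists_threshold_rpow_neg hb1 hα2 (by norm_num : (0 : ℝ) < 4) Cm
  refine ⟨2 * Cm, max (max (max a₁ a₂) (max a₃ a₄)) a₅,
    lt_max_of_lt_left (lt_max_of_lt_left (lt_max_of_lt_left ha₁)),
    fun a ha T hT e he q v p R hER hIE => ?_⟩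
  have ha' := le_of_max_le_left ha
  have ha5 : a₅ ≤ a := le_of_max_le_right ha
  have ha1' : a₁ ≤ a := le_of_max_le_left (le_of_max_le_left ha')
  have ha2' : a₂ ≤ a := le_of_max_le_right (le_of_max_le_left ha')
  have ha3' : a₃ ≤ a := le_of_max_le_left (le_of_max_le_right ha')
  have ha4' : a₄ ≤ a := le_of_max_le_right (le_of_max_le_right ha')
  have ha1 : (1 : ℝ) ≤ a := by linarith
  -- positivity of the parameters
  have hT0 : (0 : ℝ) ≤ T := hT.le
  have hf0 := freq_pos (b := b) ha1 q
  have hf1 := freq_pos (b := b) ha1 (q + 1)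
  have hA1 : 0 < amp β a b (q + 1) := amp_pos ha1 _
  have hs0 : 0 ≤ Real.sqrt (amp β a b q) := Real.sqrt_nonneg _
  have hs1 : 0 ≤ Real.sqrt (amp β a b (q + 1)) := Real.sqrt_nonneg _
  have hs1' : Real.sqrt (amp β a b (q + 1)) ≤ 1 := Real.sqrt_le_one.2 (amp_le_one ha1 hβ.le _)
  have hℓ0 : 0 < mollScale β α a b q := mollScale_pos ha1 q
  have hr0 : 0 ≤ freq a b q ^ (-α) := Real.rpow_nonneg hf0.le _
  have hr0' : freq a b q ^ (-α) ≤ 1 := freq_rpow_neg_le_one ha1 hα.le q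
  have hrℓ : 0 ≤ mollScale β α a b q ^ α := Real.rpow_nonneg hℓ0.le _
  have hr1 : 0 ≤ freq a b (q + 1) ^ (-1 + 4 * α) := Real.rpow_nonneg hf1.le _
  have hr2 : 0 ≤ freq a b q ^ (1 + 2 * α) := Real.rpow_nonneg hf0.le _
  have hi1 : (0 : ℝ) ≤ (freq a b (q + 1))⁻¹ := inv_nonneg.2 hf1.le
  have hℓα : mollScale β α a b q ^ α ≤ freq a b q ^ (-α) :=
    mollScale_rpow_le ha1 hb1 hβ.le hα.le q
  -- the thresholds at this `a`, `q`
  have hG2 : Cm * freq a b q ^ (-α) ≤ 1 := by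
    have := h4 a ha4' q
    linarith
  have hG1 : 2 * Cm * mollScale β α a b q ^ α ≤ freq a b q ^ (-α) / 2 := by
    have k1 := mollScale_rpow_le_mul ha1 hb1 hβ.le hα.le q
    have k2 : Cm * freq a b q ^ (-(3 * α ^ 2 / 2)) ≤ 4 / 16 := h5 a ha5 q
    have k3 := mul_le_mul_of_nonneg_left k1 hCm0
    have k4 : Cm * (freq a b q ^ (-α) * freq a b q ^ (-(3 * α ^ 2 / 2))) =
        freq a b q ^ (-α) * (Cm * freq a b q ^ (-(3 * α ^ 2 / 2))) := by ring
    have k5 := mul_le_mul_of_nonneg_left k2 hr0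
    linarith
  -- stage 1: mollification
  obtain ⟨vℓ, pℓ, Rℓ, hERℓ, h12, h13, h14, h15⟩ :=
    h1a a ha1' T hT q v p R hER hIE.stress_le hIE.velocity_C1_le
  -- stage 2: gluing
  obtain ⟨vbar, pbar, Rbar, hERb, hsupp, h18, h19, h20, h21, h22⟩ :=
    h2a a ha2' T hT q vℓ pℓ Rℓ hERℓ h13 h14
  -- slices are smooth
  have hvs : ∀ t ∈ Icc 0 T, FunctionSpaces.Torus.IsSmooth (v t) := fun t ht =>
    hER.smooth_velocity.isSmooth_slice ht
  have hvℓs : ∀ t ∈ Icc 0 T, FunctionSpaces.Torus.IsSmooth (vℓ t) := fun t ht =>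
    hERℓ.smooth_velocity.isSmooth_slice ht
  have hvbars : ∀ t ∈ Icc 0 T, FunctionSpaces.Torus.IsSmooth (vbar t) := fun t ht =>
    hERb.smooth_velocity.isSmooth_slice ht
  -- weaken the constants to `Cm`
  have h12' : SupLE T (fun t x => vℓ t x - v t x)
      (Cm * (Real.sqrt (amp β a b (q + 1)) * freq a b q ^ (-α))) :=
    h12.mono (mul_le_mul_of_nonneg_right hC₁m (mul_nonneg hs1 hr0))
  have h18' : SupLE T (fun t x => vbar t x - vℓ t x)
      (Cm * (Real.sqrt (amp β a b (q + 1)) * mollScale β α a b q ^ α)) :=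
    h18.mono (mul_le_mul_of_nonneg_right hC₂m (mul_nonneg hs1 hrℓ))
  have h15' : ∀ t ∈ Icc 0 T, |(∫ x, ‖v t x‖ ^ 2) - ∫ x, ‖vℓ t x‖ ^ 2| ≤
      Cm * (amp β a b (q + 1) * mollScale β α a b q ^ α) := fun t ht =>
    (h15 t ht).trans (mul_le_mul_of_nonneg_right hC₁m (mul_nonneg hA1.le hrℓ))
  have h22' : ∀ t ∈ Icc 0 T, |(∫ x, ‖vbar t x‖ ^ 2) - ∫ x, ‖vℓ t x‖ ^ 2| ≤
      Cm * (amp β a b (q + 1) * mollScale β α a b q ^ α) := fun t ht =>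
    (h22 t ht).trans (mul_le_mul_of_nonneg_right hC₂m (mul_nonneg hA1.le hrℓ))
  -- `‖v̄_q‖₀ ≤ 3` ((2.5), (2.12), (2.18))
  have hvbar0 : SupLE T vbar 3 := by
    intro t ht x
    have e1 : vbar t x = v t x + (vℓ t x - v t x) + (vbar t x - vℓ t x) := by abel
    rw [e1]
    refine (norm_add₃_le).trans ?_
    have k1 := hIE.velocity_le t ht x
    have k2 := h12' t ht x
    have k3 := h18' t ht x
    have k4 : Cm * (Real.sqrt (amp β a b (q + 1)) * freq a b q ^ (-α)) ≤ 1 := by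
      have : Real.sqrt (amp β a b (q + 1)) * freq a b q ^ (-α) ≤ freq a b q ^ (-α) := by
        calc _ ≤ 1 * freq a b q ^ (-α) := mul_le_mul_of_nonneg_right hs1' hr0
          _ = _ := one_mul _
      have := mul_le_mul_of_nonneg_left this hCm0
      linarith
    have k5 : Cm * (Real.sqrt (amp β a b (q + 1)) * mollScale β α a b q ^ α) ≤ 1 := by
      have : Real.sqrt (amp β a b (q + 1)) * mollScale β α a b q ^ α ≤ freq a b q ^ (-α) := by
        calc _ ≤ 1 * freq a b q ^ (-α) := mul_le_mul hs1' hℓα hrℓ zero_le_one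
          _ = _ := one_mul _
      have := mul_le_mul_of_nonneg_left this hCm0
      linarith
    have k6 : 0 ≤ Real.sqrt (amp β a b q) := hs0
    linarith
  -- the energy gap (5.2) ((2.6), (2.15), (2.22))
  have hgap : ∀ t ∈ Icc 0 T,
      amp β a b (q + 1) * freq a b q ^ (-α) / 2 ≤ e t - ∫ x, ‖vbar t x‖ ^ 2 ∧
        e t - ∫ x, ‖vbar t x‖ ^ 2 ≤ 2 * amp β a b (q + 1) := by
    intro t ht
    have k1 := hIE.energy_ge t ht
    have k2 := hIE.energy_le t ht
    have k3 := abs_le.1 (h15' t ht)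
    have k4 := abs_le.1 (h22' t ht)
    have k5 : 2 * (Cm * (amp β a b (q + 1) * mollScale β α a b q ^ α)) ≤
        amp β a b (q + 1) * freq a b q ^ (-α) / 2 := by
      have := mul_le_mul_of_nonneg_left hG1 hA1.le
      linarith
    have k6 : amp β a b (q + 1) * freq a b q ^ (-α) ≤ amp β a b (q + 1) := by
      calc _ ≤ amp β a b (q + 1) * 1 := mul_le_mul_of_nonneg_left hr0' hA1.le
        _ = _ := mul_one _
    constructor
    · linarith [k3.2, k4.1]
    · linarith [k3.1, k4.2]
  -- stage 3: perturbation
  obtain ⟨v', p', R', hER', h23, h61, h62⟩ :=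
    h3a a ha3' T hT e he q vbar pbar Rbar hERb hsupp hvbar0 h19 h20 h21 hgap
  -- read off the seven estimates
  have hsf0 : 0 ≤ Real.sqrt (amp β a b q) * freq a b q := mul_nonneg hs0 hf0.le
  have hCm2 : Cm ≤ 2 * Cm := by linarith
  refine ⟨vℓ, vbar, v', p', R', hvℓs, hvbars, hER', ?_, ?_, ?_, ?_, h23, ?_, ?_⟩
  · -- (2.12)
    exact h12'.mono (mul_le_mul_of_nonneg_right hCm2 (mul_nonneg hs1 hr0))
  · -- (2.13), `N = 0`
    have k := h13 0
    rw [Nat.cast_zero, neg_zero, Real.rpow_zero, mul_one, zero_add] at k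
    have k' : HolderSupLE T vℓ 1 0 (Cm * (Real.sqrt (amp β a b q) * freq a b q)) :=
      k.mono (mul_le_mul_of_nonneg_right hC₁m hsf0)
    have hB : 0 ≤ Cm * (Real.sqrt (amp β a b q) * freq a b q) := mul_nonneg hCm0 hsf0
    exact ⟨_, _, k'.supLE_of_one hB, k'.derivSupLE_of_one hB hvℓs, by linarith⟩
  · -- (2.18)
    exact h18'.mono (mul_le_mul_of_nonneg_right hCm2 (mul_nonneg hs1 hrℓ))
  · -- (2.19), `N = 0`
    have k := h19 0 (Nat.zero_le _)
    rw [Nat.cast_zero, neg_zero, Real.rpow_zero, mul_one, zero_add] at k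
    have k' : HolderSupLE T vbar 1 0 (Cm * (Real.sqrt (amp β a b q) * freq a b q)) :=
      k.mono (mul_le_mul_of_nonneg_right hC₂m hsf0)
    have hB : 0 ≤ Cm * (Real.sqrt (amp β a b q) * freq a b q) := mul_nonneg hCm0 hsf0
    exact ⟨_, _, k'.supLE_of_one hB, k'.derivSupLE_of_one hB hvbars, by linarith⟩
  · -- (2.24) = (6.1)
    exact h61.mono (mul_le_mul_of_nonneg_right (hC₃m.trans hCm2)
      (mul_nonneg (mul_nonneg (mul_nonneg hs1 hs0) hf0.le) hr1))
  · -- (2.24c) = Prop. 6.2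
    intro t ht
    exact (h62 t ht).trans (mul_le_mul_of_nonneg_right (hC₃m.trans hCm2)
      (mul_nonneg (mul_nonneg (mul_nonneg hs0 hs1) hr2) hi1))

/-- **Prop. 2.1 from the three stages**: the mollification, gluing and perturbation stages of
BDSV (Prop. 2.2, §2.5, §2.6) imply the main iterative proposition `BDSV.mainIteration`
(`BDSV.stagesEstimate_of_threeStages` followed by the printed proof of Prop. 2.1,
`BDSV.mainIteration_of_stagesEstimate`). [cite: BuckmasterEtAl2018, §2.6 (Proof of Proposition 2.1)] -/
theorem mainIteration_of_threeStages (h1 : mollificationStage) (h2 : gluingStage)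
    (h3 : perturbationStage) : mainIteration :=
  mainIteration_of_stagesEstimate (stagesEstimate_of_threeStages h1 h2 h3)

end Glue

end BDSV

end Literature.Analysis.FluidPDE
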